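import Summits.CriticalPhenomena.PercolationContinuityZ3.Theorems.Transplant.FKDoubleFanOneSidedRays
import Summits.CriticalPhenomena.PercolationContinuityZ3.Theorems.Transplant.FKDoubleFanOneSidedCasesRay1
import Summits.CriticalPhenomena.PercolationContinuityZ3.Theorems.Transplant.FKDoubleFanOneSidedCasesRay2
import Summits.CriticalPhenomena.PercolationContinuityZ3.Theorems.Transplant.FKDoubleFanOneSidedCasesRay3
import Summits.CriticalPhenomena.PercolationContinuityZ3.Theorems.Transplant.FKDoubleFanOneSidedCasesRay4
import Summits.CriticalPhenomena.PercolationContinuityZ3.Theorems.Transplant.FKDoubleFanOneSidedCasesRay5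
import Summits.CriticalPhenomena.PercolationContinuityZ3.Theorems.Transplant.FKDoubleFanOneSidedCasesRoof1
import Summits.CriticalPhenomena.PercolationContinuityZ3.Theorems.Transplant.FKDoubleFanOneSidedCasesRoof2
import Summits.CriticalPhenomena.PercolationContinuityZ3.Theorems.Transplant.FKDoubleFanOneSidedCasesRoof3
import Summits.CriticalPhenomena.PercolationContinuityZ3.Theorems.Transplant.FKDoubleFanOneSidedCasesRoof4
import Summits.CriticalPhenomena.PercolationContinuityZ3.Theorems.Transplant.FKDoubleFanOneSidedCasesRoof5
import Summits.CriticalPhenomena.PercolationContinuityZ3.Theorems.Transplant.FKDoubleFanOneSidedCasesRoofRoofA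
import Summits.CriticalPhenomena.PercolationContinuityZ3.Theorems.Transplant.FKDoubleFanOneSidedCasesRoofRoofB
import Summits.CriticalPhenomena.PercolationContinuityZ3.Theorems.Transplant.FKDoubleFanCrossFarOneSided
import HarnessLib

/-!
# Double fans, one-sided far pairs: REDUCTION of LEMMA′ to the endpoint pairs and ASSEMBLY — cross-apex negative correlation at EVERY distance
# across one-sided middles, from the single polynomial inequality CORE

Helper file (`--supports stmt-CriticalPhenomena-4575`), FK sub-lane `prim-bschramm-fk-3` (gen 32); builds on p205010 (kernel theorem, internal audit
signed; external expert review pending).  No sorries; standard axioms; ONE explicit hypothesis `FanCore q` in the final statements.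
Memo `bschramm/prim-bschramm-fk-3/FAR-CROSS-VII.md` §2–§4.

REDUCTION.  The three ray decompositions (`…OneSidedRays`) and the product bookkeeping (`…OneSidedProducts`) reduce LEMMA′ — `fanPhi q F u s ≥ 0` on
`(Valid ∧ U_c) × (Valid ∧ U_b) × (Valid ∧ U_a)`, `0 < q < 1` — to `GoodPS q P S` for every pair of ENDPOINT product vectors `P, S`, each one of the five
rays `A, D, AC, BD, 𝟙` or a roof vector `roofP q t w` (**`IsEndP`**, **`fanPhi_nonneg_of_goodPS`**): `GoodPS` is closed under non-negative combinations in
each argument and every endpoint of a leg has its product vector in the cone of the endpoint product vectors.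
ASSEMBLY.  The `…OneSidedCases*` files prove `GoodPS` at 35 of the 36 pairs unconditionally and at (roof, roof) from **`FanCore q`**: the inequality
`roofF q t_f w_f (roofP q t_u w_u) (roofP q t_s w_s) ≥ 0` (`t ≥ 0`, `w ∈ [0,1]`), `= (1−q)(2−q)·CORE` with `CORE` the explicit 370-term polynomial of memo
§10(r), numerically `≥ 0` with zeros exactly on `{w_f = w_u = 0}`.  Hence **`fanPhi_nonneg_of_core`** (LEMMA′ on `InKE³`, `0 < q ≤ 1`) and, through
`rayleigh_crossFar_oneSided_of_fanPhi` and `negCorr_spokes_cross_far_of_oneSided`, **`negCorr_spokes_cross_far_oneSided_of_core`**: for every weighted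
double fan `K₂ ∨ P_{m+1}`, `0 < q ≤ 1`, all `j < k` with the `b`-spokes strictly between `c_j` and `c_k` of weight `0`,
`φ(J_{a c_j} ∩ J_{b c_k}) ≤ φ(J_{a c_j})·φ(J_{b c_k})` — NEGATIVE CORRELATION AT EVERY DISTANCE, conditional on CORE only (and the mirror statement).
[cite: Grimmett2006, §3.9 eq. (3.94) (pp. 63–64)] [folklore]
-/

noncomputable section

namespace Summit.CriticalPhenomena.PercolationContinuityZ3.Theorems

namespace FK

namespace ThreeApex

/-! ### Linearity of `GoodPS` -/

/-- All six quantities of `GoodPS` are linear in `P`: scalar. [folklore] -/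
theorem GoodPS.smul_left {q : ℝ} {P S : P6} (h : GoodPS q P S) {c : ℝ} (hc : 0 ≤ c) : GoodPS q (P6.smul c P) S := by
  obtain ⟨h1, h2, h3, h4, h5, h6⟩ := h
  have e1 : condA q (P6.smul c P) S = c * condA q P S := by simp only [condA, P6.smul]; ring
  have e2 : condN q (P6.smul c P) S = c * condN q P S := by simp only [condN, nform, P6.smul]; ring
  have e3 : condC1 q (P6.smul c P) S = c * condC1 q P S := by simp only [condC1, P6.smul]; ring
  have e4 : condC2 q (P6.smul c P) S = c * condC2 q P S := by simp only [condC2, nform, P6.smul]; ring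
  have e5 : nform q (P6.smul c P) * nform q S = c * (nform q P * nform q S) := by simp only [nform, P6.smul]; ring
  have e6 : ∀ t w, roofF q t w (P6.smul c P) S = c * roofF q t w P S := by
    intro t w; simp only [roofF, phiX, phiZ, phi0, condA, condN, condC1, condC2, condC10, nform, P6.smul]; ring
  refine ⟨?_, ?_, ?_, ?_, ?_, ?_⟩
  · rw [e1]; exact mul_nonneg hc h1
  · rw [e2]; exact mul_nonneg hc h2
  · rw [e3]; exact mul_nonneg hc h3
  · rw [e4]; exact mul_nonneg hc h4
  · rw [e5]; exact mul_nonneg hc h5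
  · intro t w ht hw0 hw1; rw [e6]; exact mul_nonneg hc (h6 t w ht hw0 hw1)

/-- All six quantities of `GoodPS` are linear in `S`: scalar. [folklore] -/
theorem GoodPS.smul_right {q : ℝ} {P S : P6} (h : GoodPS q P S) {c : ℝ} (hc : 0 ≤ c) : GoodPS q P (P6.smul c S) := by
  obtain ⟨h1, h2, h3, h4, h5, h6⟩ := h
  have e1 : condA q P (P6.smul c S) = c * condA q P S := by simp only [condA, P6.smul]; ring
  have e2 : condN q P (P6.smul c S) = c * condN q P S := by simp only [condN, nform, P6.smul]; ring
  have e3 : condC1 q P (P6.smul c S) = c * condC1 q P S := by simp only [condC1, P6.smul]; ring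
  have e4 : condC2 q P (P6.smul c S) = c * condC2 q P S := by simp only [condC2, nform, P6.smul]; ring
  have e5 : nform q P * nform q (P6.smul c S) = c * (nform q P * nform q S) := by simp only [nform, P6.smul]; ring
  have e6 : ∀ t w, roofF q t w P (P6.smul c S) = c * roofF q t w P S := by
    intro t w; simp only [roofF, phiX, phiZ, phi0, condA, condN, condC1, condC2, condC10, nform, P6.smul]; ring
  refine ⟨?_, ?_, ?_, ?_, ?_, ?_⟩
  · rw [e1]; exact mul_nonneg hc h1
  · rw [e2]; exact mul_nonneg hc h2
  · rw [e3]; exact mul_nonneg hc h3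
  · rw [e4]; exact mul_nonneg hc h4
  · rw [e5]; exact mul_nonneg hc h5
  · intro t w ht hw0 hw1; rw [e6]; exact mul_nonneg hc (h6 t w ht hw0 hw1)

/-- All six quantities of `GoodPS` are linear in `P`: sums. [folklore] -/
theorem GoodPS.add_left {q : ℝ} {P Q S : P6} (hP : GoodPS q P S) (hQ : GoodPS q Q S) : GoodPS q (P6.add P Q) S := by
  obtain ⟨h1, h2, h3, h4, h5, h6⟩ := hP
  obtain ⟨g1, g2, g3, g4, g5, g6⟩ := hQ
  have e1 : condA q (P6.add P Q) S = condA q P S + condA q Q S := by simp only [condA, P6.add]; ring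
  have e2 : condN q (P6.add P Q) S = condN q P S + condN q Q S := by simp only [condN, nform, P6.add]; ring
  have e3 : condC1 q (P6.add P Q) S = condC1 q P S + condC1 q Q S := by simp only [condC1, P6.add]; ring
  have e4 : condC2 q (P6.add P Q) S = condC2 q P S + condC2 q Q S := by simp only [condC2, nform, P6.add]; ring
  have e5 : nform q (P6.add P Q) * nform q S = nform q P * nform q S + nform q Q * nform q S := by simp only [nform, P6.add]; ring
  have e6 : ∀ t w, roofF q t w (P6.add P Q) S = roofF q t w P S + roofF q t w Q S := by
    intro t w; simp only [roofF, phiX, phiZ, phi0, condA, condN, condC1, condC2, condC10, nform, P6.add]; ring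
  refine ⟨?_, ?_, ?_, ?_, ?_, ?_⟩
  · rw [e1]; exact add_nonneg h1 g1
  · rw [e2]; exact add_nonneg h2 g2
  · rw [e3]; exact add_nonneg h3 g3
  · rw [e4]; exact add_nonneg h4 g4
  · rw [e5]; exact add_nonneg h5 g5
  · intro t w ht hw0 hw1; rw [e6]; exact add_nonneg (h6 t w ht hw0 hw1) (g6 t w ht hw0 hw1)

/-- All six quantities of `GoodPS` are linear in `S`: sums. [folklore] -/
theorem GoodPS.add_right {q : ℝ} {P S T : P6} (hS : GoodPS q P S) (hT : GoodPS q P T) : GoodPS q P (P6.add S T) := by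
  obtain ⟨h1, h2, h3, h4, h5, h6⟩ := hS
  obtain ⟨g1, g2, g3, g4, g5, g6⟩ := hT
  have e1 : condA q P (P6.add S T) = condA q P S + condA q P T := by simp only [condA, P6.add]; ring
  have e2 : condN q P (P6.add S T) = condN q P S + condN q P T := by simp only [condN, nform, P6.add]; ring
  have e3 : condC1 q P (P6.add S T) = condC1 q P S + condC1 q P T := by simp only [condC1, P6.add]; ring
  have e4 : condC2 q P (P6.add S T) = condC2 q P S + condC2 q P T := by simp only [condC2, nform, P6.add]; ring
  have e5 : nform q P * nform q (P6.add S T) = nform q P * nform q S + nform q P * nform q T := by simp only [nform, P6.add]; ring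
  have e6 : ∀ t w, roofF q t w P (P6.add S T) = roofF q t w P S + roofF q t w P T := by
    intro t w; simp only [roofF, phiX, phiZ, phi0, condA, condN, condC1, condC2, condC10, nform, P6.add]; ring
  refine ⟨?_, ?_, ?_, ?_, ?_, ?_⟩
  · rw [e1]; exact add_nonneg h1 g1
  · rw [e2]; exact add_nonneg h2 g2
  · rw [e3]; exact add_nonneg h3 g3
  · rw [e4]; exact add_nonneg h4 g4
  · rw [e5]; exact add_nonneg h5 g5
  · intro t w ht hw0 hw1; rw [e6]; exact add_nonneg (h6 t w ht hw0 hw1) (g6 t w ht hw0 hw1)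

/-! ### Endpoint product vectors and their cone -/

/-- **Endpoint product vectors**: the five rays `A, D, AC, BD, 𝟙` and the roof vectors `roofP q t w` (`t ≥ 0`, `w ∈ [0,1]`). [folklore] -/
def IsEndP (q : ℝ) (P : P6) : Prop :=
  P = rayA ∨ P = rayD ∨ P = rayAC ∨ P = rayBD ∨ P = rayOne ∨ ∃ t w : ℝ, 0 ≤ t ∧ 0 ≤ w ∧ w ≤ 1 ∧ P = roofP q t w

/-- The cone used by the endpoints of a leg: `c_A·A + c_AC·AC + c_D·D + c_BD·BD + c₁·𝟙 + c_R·roofP q t w` with all `c ≥ 0`. [folklore] -/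
def InEndCone (q : ℝ) (P : P6) : Prop :=
  ∃ cA cAC cD cBD c1 cR t w : ℝ, 0 ≤ cA ∧ 0 ≤ cAC ∧ 0 ≤ cD ∧ 0 ≤ cBD ∧ 0 ≤ c1 ∧ 0 ≤ cR ∧ 0 ≤ t ∧ 0 ≤ w ∧ w ≤ 1 ∧
    P = P6.add (P6.add (P6.add (P6.smul cA rayA) (P6.smul cAC rayAC)) (P6.add (P6.smul cD rayD) (P6.smul cBD rayBD)))
          (P6.add (P6.smul c1 rayOne) (P6.smul cR (roofP q t w)))

/-- The degenerate frame's products lie in the cone. [folklore] -/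
theorem inEndCone_deg (q : ℝ) {y u0 : ℝ} (hu0 : 0 ≤ u0) (hyu : u0 ≤ y) : InEndCone q (uprods (vecB q (q * y) y 0 0 u0)) := by
  refine ⟨0, 0, 0, 0, u0 * y, 0, 0, 0, le_rfl, le_rfl, le_rfl, le_rfl, mul_nonneg hu0 (hu0.trans hyu), le_rfl, le_rfl, le_rfl,
    zero_le_one, ?_⟩
  rw [uprods_deg]
  ext <;> simp [P6.smul, P6.add, rayA, rayAC, rayD, rayBD, rayOne, roofP]

/-- A floor point's products lie in the cone. [folklore] -/
theorem inEndCone_floor (q : ℝ) {W y X Z : ℝ} (hX : 0 ≤ X) (hZ : 0 ≤ Z) (hy : 0 ≤ y) (hW : q * y < W) :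
    InEndCone q (uprods (vecB q W y X Z 0)) := by
  have hl : 0 ≤ W - q * y := by linarith
  refine ⟨X * (W - q * y), X * y, Z * (W - q * y), Z * y, 0, 0, 0, 0, mul_nonneg hX hl, mul_nonneg hX hy, mul_nonneg hZ hl,
    mul_nonneg hZ hy, le_rfl, le_rfl, le_rfl, le_rfl, zero_le_one, ?_⟩
  rw [uprods_floor]
  ext <;> simp [P6.smul, P6.add, rayA, rayAC, rayD, rayBD, rayOne, roofP]

/-- A roof point's products lie in the cone. [folklore] -/
theorem inEndCone_roof (q : ℝ) {κ l t w : ℝ} (hκ : 0 ≤ κ) (hl : 0 < l) (ht : 0 ≤ t) (hw0 : 0 ≤ w) (hw1 : w ≤ 1) :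
    InEndCone q (uprods (roofV q κ l t w)) := by
  refine ⟨0, 0, 0, 0, 0, κ * l, t, w, le_rfl, le_rfl, le_rfl, le_rfl, le_rfl, mul_nonneg hκ hl.le, ht, hw0, hw1, ?_⟩
  rw [uprods_roofV]
  ext <;> simp [P6.smul, P6.add, rayA, rayAC, rayD, rayBD, rayOne]

/-- `GoodPS` on all endpoint pairs extends to the cones. [folklore] -/
theorem goodPS_of_cone {q : ℝ} (H : ∀ P S : P6, IsEndP q P → IsEndP q S → GoodPS q P S) {P S : P6} (hP : InEndCone q P)
    (hS : InEndCone q S) : GoodPS q P S := by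
  -- first: every endpoint `P'` is good against the cone element `S`
  have step : ∀ P' : P6, IsEndP q P' → GoodPS q P' S := by
    intro P' hP'
    obtain ⟨cA, cAC, cD, cBD, c1, cR, t, w, hA, hAC, hD, hBD, h1, hR, ht, hw0, hw1, rfl⟩ := hS
    have g := fun (T : P6) (hT : IsEndP q T) => H P' T hP' hT
    refine GoodPS.add_right (GoodPS.add_right (GoodPS.add_right ?_ ?_) (GoodPS.add_right ?_ ?_)) (GoodPS.add_right ?_ ?_)
    · exact (g rayA (Or.inl rfl)).smul_right hA
    · exact (g rayAC (Or.inr (Or.inr (Or.inl rfl)))).smul_right hAC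
    · exact (g rayD (Or.inr (Or.inl rfl))).smul_right hD
    · exact (g rayBD (Or.inr (Or.inr (Or.inr (Or.inl rfl))))).smul_right hBD
    · exact (g rayOne (Or.inr (Or.inr (Or.inr (Or.inr (Or.inl rfl)))))).smul_right h1
    · exact (g (roofP q t w) (Or.inr (Or.inr (Or.inr (Or.inr (Or.inr ⟨t, w, ht, hw0, hw1, rfl⟩)))))).smul_right hR
  obtain ⟨cA, cAC, cD, cBD, c1, cR, t, w, hA, hAC, hD, hBD, h1, hR, ht, hw0, hw1, rfl⟩ := hP
  refine GoodPS.add_left (GoodPS.add_left (GoodPS.add_left ?_ ?_) (GoodPS.add_left ?_ ?_)) (GoodPS.add_left ?_ ?_)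
  · exact (step rayA (Or.inl rfl)).smul_left hA
  · exact (step rayAC (Or.inr (Or.inr (Or.inl rfl)))).smul_left hAC
  · exact (step rayD (Or.inr (Or.inl rfl))).smul_left hD
  · exact (step rayBD (Or.inr (Or.inr (Or.inr (Or.inl rfl))))).smul_left hBD
  · exact (step rayOne (Or.inr (Or.inr (Or.inr (Or.inr (Or.inl rfl)))))).smul_left h1
  · exact (step (roofP q t w) (Or.inr (Or.inr (Or.inr (Or.inr (Or.inr ⟨t, w, ht, hw0, hw1, rfl⟩)))))).smul_left hR

/-! ### The reduction -/

/-- The fan leg against a good pair of product cones: `fanPhi q F u s ≥ 0` for every `F` with masses `≥ 0` and `(U_c)`, once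
`GoodPS q (uprods u) (sprods s)` (`0 < q < 1`). [folklore] -/
theorem fanPhi_nonneg_of_goodPS_prods {q : ℝ} (hq0 : 0 < q) (hq1 : q < 1) {u s : V5} (hG : GoodPS q (uprods u) (sprods s))
    {F : V5} (hF : F.Nonneg) (hFU : UCond q (swapAC F)) : 0 ≤ fanPhi q F u s := by
  obtain ⟨hA, hN, hC1, hC2, hNN, hRF⟩ := hG
  refine fanPhi_legC_nonneg hq0 hq1 ?_ ?_ ?_ hF hFU
  · intro y u0 hu0 hyu
    rw [fanVec_deg, fanPhi_eq_P]
    exact fanPhiP_degF_nonneg hq1.le hNN hu0 (sub_nonneg.2 hyu)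
  · intro W y X Z hX hZ hy hW h1
    rw [fanVec_floor, fanPhi_eq_P]
    exact fanPhiP_floorF_nonneg hq1.le hA hN hC1 hC2 hy hZ hX h1
  · intro κ l t w hκ hl ht hw0 hw1
    rw [fanPhi_eq_P, fanPhiP_roofF]
    exact mul_nonneg (mul_nonneg hκ hl.le) (hRF t w ht hw0 hw1)

/-- **THE REDUCTION.**  If `GoodPS q P S` holds for every pair of endpoint product vectors, then LEMMA′ holds at `q ∈ (0,1)`:
`fanPhi q F u s ≥ 0` for all `F, u, s` with masses `≥ 0` and `(U_c)(F)`, `(U_b)(u)`, `(U_a)(s)`. [folklore] -/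
theorem fanPhi_nonneg_of_goodPS {q : ℝ} (hq0 : 0 < q) (hq1 : q < 1) (H : ∀ P S : P6, IsEndP q P → IsEndP q S → GoodPS q P S)
    {F u s : V5} (hF : F.Nonneg) (hFU : UCond q (swapAC F)) (hu : u.Nonneg) (huU : UCond q (swapAB u)) (hs : s.Nonneg)
    (hsU : UCond q s) : 0 ≤ fanPhi q F u s := by
  -- leg `u`, then leg `s`, then the fan leg
  have inner : ∀ u' : V5, InEndCone q (uprods u') → 0 ≤ fanPhi q F u' s := by
    intro u' hu'
    refine fanPhi_legA_nonneg hq0 hq1 ?_ ?_ ?_ hs hsU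
    · intro y u0 hu0 hyu
      refine fanPhi_nonneg_of_goodPS_prods hq0 hq1 (goodPS_of_cone H hu' ?_) hF hFU
      rw [sprods_eq, swapAB_swapAB]; exact inEndCone_deg q hu0 hyu
    · intro W y X Z hX hZ hy hW _
      refine fanPhi_nonneg_of_goodPS_prods hq0 hq1 (goodPS_of_cone H hu' ?_) hF hFU
      rw [sprods_eq, swapAB_swapAB]; exact inEndCone_floor q hX hZ hy hW
    · intro κ l t w hκ hl ht hw0 hw1
      refine fanPhi_nonneg_of_goodPS_prods hq0 hq1 (goodPS_of_cone H hu' ?_) hF hFU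
      rw [sprods_eq, swapAB_swapAB]; exact inEndCone_roof q hκ hl ht hw0 hw1
  refine fanPhi_legB_nonneg hq0 hq1 ?_ ?_ ?_ hu huU
  · intro y u0 hu0 hyu; exact inner _ (inEndCone_deg q hu0 hyu)
  · intro W y X Z hX hZ hy hW _; exact inner _ (inEndCone_floor q hX hZ hy hW)
  · intro κ l t w hκ hl ht hw0 hw1; exact inner _ (inEndCone_roof q hκ hl ht hw0 hw1)

/-- **THE REDUCTION on `InKE³`, all `0 < q ≤ 1`** (at `q = 1` the form vanishes identically). [folklore] -/
theorem fanPhi_nonneg_inKE_of_goodPS {q : ℝ} (hq0 : 0 < q) (hq1 : q ≤ 1)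
    (H : q < 1 → ∀ P S : P6, IsEndP q P → IsEndP q S → GoodPS q P S) (F u s : V5) (hF : InKE q F) (hu : InKE q u)
    (hs : InKE q s) : 0 ≤ fanPhi q F u s := by
  rcases eq_or_lt_of_le hq1 with h1 | h1
  · subst h1
    have : fanPhi 1 F u s = 0 := by simp only [fanPhi]; ring
    rw [this]
  · exact fanPhi_nonneg_of_goodPS hq0 h1 (H h1) (hF.valid hq0.le hq1).nonneg (hF.uCondC hq0 hq1) (hu.valid hq0.le hq1).nonneg
      (hu.uCondB hq0 hq1) (hs.valid hq0.le hq1).nonneg (hs.uCond hq0 hq1)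

/-! ### Assembly from CORE -/

/-- **CORE** (the one remaining polynomial inequality of LEMMA′): the roof functional of the fan leg is `≥ 0` when both outer legs are at roof
points — `roofF q t_f w_f (roofP q t_u w_u) (roofP q t_s w_s) ≥ 0` for `t ≥ 0`, `w ∈ [0,1]` (`= (1−q)(2−q)·CORE₃₇₀`). [folklore] -/
def FanCore (q : ℝ) : Prop :=
  ∀ tf wf tu wu ts ws : ℝ, 0 ≤ tf → 0 ≤ wf → wf ≤ 1 → 0 ≤ tu → 0 ≤ wu → wu ≤ 1 → 0 ≤ ts → 0 ≤ ws → ws ≤ 1 →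
    0 ≤ roofF q tf wf (roofP q tu wu) (roofP q ts ws)

/-- **`GoodPS` at the endpoint pair (R, R)** (both outer legs at roof points), given CORE for the sixth conjunct. [folklore] -/
theorem goodPS_R_R {q tu wu ts ws : ℝ} (hq0 : 0 ≤ q) (hq1 : q ≤ 1) (htu : 0 ≤ tu) (hwu0 : 0 ≤ wu) (hwu1 : wu ≤ 1) (hts : 0 ≤ ts)
    (hws0 : 0 ≤ ws) (hws1 : ws ≤ 1) (hcore : ∀ tf wf : ℝ, 0 ≤ tf → 0 ≤ wf → wf ≤ 1 → 0 ≤ roofF q tf wf (roofP q tu wu) (roofP q ts ws)) :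
    GoodPS q (roofP q tu wu) (roofP q ts ws) :=
  ⟨gps_R_R_condA hq0 hq1 htu hwu0 hwu1 hts hws0 hws1, gps_R_R_condN hq0 hq1 htu hwu0 hwu1 hts hws0 hws1,
    gps_R_R_condC1 hq0 hq1 htu hwu0 hwu1 hts hws0 hws1, gps_R_R_condC2 hq0 hq1 htu hwu0 hwu1 hts hws0 hws1,
    gps_R_R_nn hq0 hq1 htu hwu0 hwu1 hts hws0 hws1, hcore⟩

/-- **All 36 endpoint pairs are good**, given CORE (`0 ≤ q ≤ 1`). [folklore] -/
theorem goodPS_endpoints {q : ℝ} (hq0 : 0 ≤ q) (hq1 : q ≤ 1) (hcore : FanCore q) :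
    ∀ P S : P6, IsEndP q P → IsEndP q S → GoodPS q P S := by
  rintro P S hP hS
  rcases hP with rfl | rfl | rfl | rfl | rfl | ⟨tu, wu, htu, hwu0, hwu1, rfl⟩ <;>
    rcases hS with rfl | rfl | rfl | rfl | rfl | ⟨ts, ws, hts, hws0, hws1, rfl⟩
  · exact goodPS_A_A hq0 hq1
  · exact goodPS_A_D hq0 hq1
  · exact goodPS_A_AC hq0 hq1
  · exact goodPS_A_BD hq0 hq1
  · exact goodPS_A_One hq0 hq1
  · exact goodPS_A_R hq0 hq1 hts hws0 hws1
  · exact goodPS_D_A hq0 hq1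
  · exact goodPS_D_D hq0 hq1
  · exact goodPS_D_AC hq0 hq1
  · exact goodPS_D_BD hq0 hq1
  · exact goodPS_D_One hq0 hq1
  · exact goodPS_D_R hq0 hq1 hts hws0 hws1
  · exact goodPS_AC_A hq0 hq1
  · exact goodPS_AC_D hq0 hq1
  · exact goodPS_AC_AC hq0 hq1
  · exact goodPS_AC_BD hq0 hq1
  · exact goodPS_AC_One hq0 hq1
  · exact goodPS_AC_R hq0 hq1 hts hws0 hws1
  · exact goodPS_BD_A hq0 hq1
  · exact goodPS_BD_D hq0 hq1
  · exact goodPS_BD_AC hq0 hq1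
  · exact goodPS_BD_BD hq0 hq1
  · exact goodPS_BD_One hq0 hq1
  · exact goodPS_BD_R hq0 hq1 hts hws0 hws1
  · exact goodPS_One_A hq0 hq1
  · exact goodPS_One_D hq0 hq1
  · exact goodPS_One_AC hq0 hq1
  · exact goodPS_One_BD hq0 hq1
  · exact goodPS_One_One hq0 hq1
  · exact goodPS_One_R hq0 hq1 hts hws0 hws1
  · exact goodPS_R_A hq0 hq1 htu hwu0 hwu1
  · exact goodPS_R_D hq0 hq1 htu hwu0 hwu1
  · exact goodPS_R_AC hq0 hq1 htu hwu0 hwu1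
  · exact goodPS_R_BD hq0 hq1 htu hwu0 hwu1
  · exact goodPS_R_One hq0 hq1 htu hwu0 hwu1
  · exact goodPS_R_R hq0 hq1 htu hwu0 hwu1 hts hws0 hws1
      (fun tf wf htf hwf0 hwf1 => hcore tf wf tu wu ts ws htf hwf0 hwf1 htu hwu0 hwu1 hts hws0 hws1)

/-- **LEMMA′ from CORE**: `fanPhi q F u s ≥ 0` for all `F, u, s ∈ InKE q`, `0 < q ≤ 1`. [folklore] -/
theorem fanPhi_nonneg_of_core {q : ℝ} (hq0 : 0 < q) (hq1 : q ≤ 1) (hcore : FanCore q) (F u s : V5) (hF : InKE q F) (hu : InKE q u)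
    (hs : InKE q s) : 0 ≤ fanPhi q F u s :=
  fanPhi_nonneg_inKE_of_goodPS hq0 hq1 (fun _ => goodPS_endpoints hq0.le hq1 hcore) F u s hF hu hs

/-- **LEMMA′ from CORE, relaxed form**: masses `≥ 0` and `(U_c)(F)`, `(U_b)(u)`, `(U_a)(s)` suffice (`0 < q < 1`). [folklore] -/
theorem fanPhi_nonneg_validU_of_core {q : ℝ} (hq0 : 0 < q) (hq1 : q < 1) (hcore : FanCore q) {F u s : V5} (hF : F.Nonneg)
    (hFU : UCond q (swapAC F)) (hu : u.Nonneg) (huU : UCond q (swapAB u)) (hs : s.Nonneg) (hsU : UCond q s) : 0 ≤ fanPhi q F u s :=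
  fanPhi_nonneg_of_goodPS hq0 hq1 (goodPS_endpoints hq0.le hq1.le hcore) hF hFU hu huU hs hsU

open MeasureTheory Literature.Probability.LatticeModels Literature.Probability.Percolation
open scoped Classical

variable {V : Type*} [Fintype V]
variable {a b : V} {c : ℕ → V} {m : ℕ}
variable (hab : a ≠ b) (hinj : ∀ j k, j ≤ m → k ≤ m → c j = c k → j = k) (hca : ∀ j, j ≤ m → c j ≠ a) (hcb : ∀ j, j ≤ m → c j ≠ b)
include hab hinj hca hcb

/-- **THE ONE-SIDED FAR THEOREM from CORE.**  For every weighted double fan (`card V = m+3`, weights supported on the double-fan pairs), `0 < q ≤ 1`,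
and `j < k ≤ m` such that the `b`-spokes strictly between `c_j` and `c_k` carry weight `0`:
`φ(J_{a c_j} ∩ J_{b c_k}) ≤ φ(J_{a c_j})·φ(J_{b c_k})` — at EVERY distance `k − j`. [folklore] -/
theorem negCorr_spokes_cross_far_oneSided_of_core (hcard : Fintype.card V = m + 3) {q : ℝ} (hq0 : 0 < q) (hq1 : q ≤ 1) (hcore : FanCore q)
    (w : Sym2 V → unitInterval) (hsupp : ∀ e, e ∉ dfPairs a b c m → w e = 0) {j k : ℕ} (hjk : j < k) (hk : k ≤ m)
    (hb0 : ∀ i, j < i → i < k → w s(b, c i) = 0) :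
    (rcMeasureW w q ∅).real ({ω : BondConfig V | s(a, c j) ∈ ω} ∩ {ω | s(b, c k) ∈ ω}) ≤
      (rcMeasureW w q ∅).real {ω : BondConfig V | s(a, c j) ∈ ω} * (rcMeasureW w q ∅).real {ω : BondConfig V | s(b, c k) ∈ ω} :=
  negCorr_spokes_cross_far_of_oneSided hab hinj hca hcb hcard hq0 w hsupp
    (fun _ hm hy _ hrd0 hrd1 _ _ hu hs =>
      rayleigh_crossFar_oneSided_of_fanPhi (fun F u s hF hu hs => fanPhi_nonneg_of_core hq0 hq1 hcore F u s hF hu hs) hm hy hrd0 hrd1 hu hs)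
    hjk hk hb0

/-- The mirror statement from CORE: `a`-spokes vanishing strictly between `c_j` and `c_k` ⇒ `(b c_j, a c_k)` negatively correlated. [folklore] -/
theorem negCorr_spokes_cross_far_oneSided_of_core' (hcard : Fintype.card V = m + 3) {q : ℝ} (hq0 : 0 < q) (hq1 : q ≤ 1) (hcore : FanCore q)
    (w : Sym2 V → unitInterval) (hsupp : ∀ e, e ∉ dfPairs a b c m → w e = 0) {j k : ℕ} (hjk : j < k) (hk : k ≤ m)
    (ha0 : ∀ i, j < i → i < k → w s(a, c i) = 0) :
    (rcMeasureW w q ∅).real ({ω : BondConfig V | s(b, c j) ∈ ω} ∩ {ω | s(a, c k) ∈ ω}) ≤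
      (rcMeasureW w q ∅).real {ω : BondConfig V | s(b, c j) ∈ ω} * (rcMeasureW w q ∅).real {ω : BondConfig V | s(a, c k) ∈ ω} :=
  negCorr_spokes_cross_far_of_oneSided' hab hinj hca hcb hcard hq0 w hsupp
    (fun _ hm hy _ hrd0 hrd1 _ _ hu hs =>
      rayleigh_crossFar_oneSided_of_fanPhi (fun F u s hF hu hs => fanPhi_nonneg_of_core hq0 hq1 hcore F u s hF hu hs) hm hy hrd0 hrd1 hu hs)
    hjk hk ha0

end ThreeApex

end FK

end Summit.CriticalPhenomena.PercolationContinuityZ3.Theorems
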